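import Literature.Computability.QuantumComplexity.BarencoControlledGates
import Literature.Computability.QuantumComplexity.TwoLevelUnitary
import Literature.Computability.QuantumComplexity.CliffordTUniversality
import HarnessLib

/-!
# Exact universality of one-qubit gates and `CNOT` (Barenco et al. 1995) — discharged

Topic `Literature/Computability/QuantumComplexity`, grouping namespace `Barenco`. Discharge of the
named fact `barenco1995_exactUniversality` of `HTCnotUniversality.lean`: for every `n ≥ 1`, the
placements of one-qubit unitaries and of `CNOT` on `n` wires generate all of `U(2^n)`
(Barenco–Bennett–Cleve–DiVincenzo–Margolus–Shor–Sleator–Smolin–Weinfurter 1995, abstract and §8;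
Nielsen–Chuang 2010, §4.5.2, "single qubit and CNOT gates are universal").

The proof assembles the two layers already in the tree with the wire bookkeeping of
Nielsen–Chuang §4.5.2 (there done with Gray codes):

* `TwoLevelUnitary.mem_twoLevelClosure` — every unitary is a product of two-level unitaries;
* `BarencoControlledGates.inGen_mc` — every multi-controlled one-qubit gate `∧_C(W)` is generated
  by one-qubit gates and `CNOT`s;
* here: a two-level unitary on the labels `x ≠ y` of `QReg n` is conjugated, by `X` gates and
  `CNOT` gates (both permutation matrices of the labels, `permMatrix_conj_twoLevel`), to a
  two-level unitary on the *canonical pair* `(1⋯1 0ₚ 1⋯1, 1⋯1)`, which is the fully controlled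
  gate `∧_{univ ∖ {p}}(W)` with block `W = [[a, b], [c, d]]` (`twoLevel_canon_eq_mc`). The
  reduction (`inGen_twoLevel_of_badness_le`) is an induction on a weight counting the wires
  `q ≠ p` whose bits are not yet `(1, 1)`: `X_q` fixes `(0, 0)` and turns `(0, 1)` into `(1, 0)`,
  `CNOT_{p→q}` fixes `(1, 0)` (the pivot bits are `x_p = 0`, `y_p = 1`).

Main results: `inGen_twoLevel`, **`barenco1995_exactUniversality_holds`**, and the corollary
`cliffordT_isUniversal_of_HT` reducing `cliffordT_isUniversal` to the density of `⟨H, T⟩` alone.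

## References

* A. Barenco et al., *Elementary gates for quantum computation*, Phys. Rev. A 52 (1995)
  3457–3467, arXiv:quant-ph/9503016, abstract and §8 [BarencoEtAl1995].
* M. A. Nielsen, I. L. Chuang, *Quantum Computation and Quantum Information*, CUP 2010, §4.5.2
  (Figs. 4.15–4.16) [NielsenChuang2010].
-/

noncomputable section

namespace Literature.Computability.QuantumComplexity

namespace Barenco

open Cryptography Matrix OneQubit

variable {n : ℕ}

/-! ### Two-level matrices under label permutations -/

/-- Swapping the two labels of a two-level matrix transposes its block pattern. [folklore] -/
theorem twoLevel_swap {x y : QReg n} (hxy : x ≠ y) (a b c d : ℂ) :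
    twoLevel x y a b c d = twoLevel y x d c b a := by
  ext u v
  simp only [twoLevel]
  by_cases hux : u = x <;> by_cases huy : u = y <;> by_cases hvx : v = x <;> by_cases hvy : v = y <;>
    simp_all

/-- **Conjugating a two-level matrix by a permutation matrix** relabels it:
`P_σ · T_{x,y} · P_σ⁻¹ = T_{σ⁻¹x, σ⁻¹y}` (same block). [folklore] -/
theorem permMatrix_conj_twoLevel (σ : Equiv.Perm (QReg n)) (x y : QReg n) (a b c d : ℂ) :
    σ.permMatrix ℂ * twoLevel x y a b c d * σ⁻¹.permMatrix ℂ = twoLevel (σ.symm x) (σ.symm y) a b c d := by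
  rw [permMatrix_mul_mul_permMatrix_inv]
  ext u v
  simp only [Matrix.submatrix_apply, twoLevel, Matrix.one_apply, Equiv.apply_eq_iff_eq_symm_apply,
    Equiv.symm_apply_apply]

/-- Hence, for an involutive label permutation `σ` whose matrix is generated, a two-level unitary
is generated as soon as its `σ`-relabelling is. [folklore] -/
theorem InGen.of_perm {σ : Equiv.Perm (QReg n)} (hσ : σ⁻¹ = σ) (hP : InGen n (σ.permMatrix ℂ))
    {x y : QReg n} {a b c d : ℂ} (h : InGen n (twoLevel (σ x) (σ y) a b c d)) :
    InGen n (twoLevel x y a b c d) := by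
  have key : σ.permMatrix ℂ * twoLevel (σ x) (σ y) a b c d * σ.permMatrix ℂ = twoLevel x y a b c d := by
    have h' := permMatrix_conj_twoLevel σ (σ x) (σ y) a b c d
    rwa [hσ, Equiv.symm_apply_apply, Equiv.symm_apply_apply] at h'
  rw [← key]
  exact (hP.mul h).mul hP

/-! ### The two label permutations: `X` on a wire, `CNOT` on two wires -/

/-- The bit flip on wire `q` (the permutation of `X_q`). [folklore] -/
def xPerm (q : Fin n) : Equiv.Perm (QReg n) :=
  flipPerm q fun z => ∀ c ∈ (∅ : Finset (Fin n)), z c = true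

/-- The `CNOT` permutation with control `p` and target `q`. [folklore] -/
def cnotPerm (p q : Fin n) : Equiv.Perm (QReg n) :=
  flipPerm q fun z => ∀ c ∈ ({p} : Finset (Fin n)), z c = true

/-- Action of `xPerm`. [folklore] -/
theorem xPerm_apply (q : Fin n) (x : QReg n) : xPerm q x = Function.update x q (!x q) := by
  rw [xPerm, flipPerm_apply, if_pos]
  simp

/-- Action of `cnotPerm` (`p ≠ q`). [folklore] -/
theorem cnotPerm_apply {p q : Fin n} (hpq : p ≠ q) (x : QReg n) :
    cnotPerm p q x = if x p = true then Function.update x q (!x q) else x := by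
  rw [cnotPerm, flipPerm_apply]
  simp [clr_apply_of_ne hpq]

/-- `xPerm` is an involution. [folklore] -/
theorem xPerm_inv (q : Fin n) : (xPerm q)⁻¹ = xPerm q := flipPerm_inv _ _

/-- `cnotPerm` is an involution. [folklore] -/
theorem cnotPerm_inv (p q : Fin n) : (cnotPerm p q)⁻¹ = cnotPerm p q := flipPerm_inv _ _

/-- The matrix of `xPerm q` is `X` placed on wire `q`, hence generated. [folklore] -/
theorem inGen_xPerm (q : Fin n) : InGen n ((xPerm q).permMatrix ℂ) := by
  rw [xPerm, ← mc_pauliX]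
  exact inGen_mc_zero q pauliX_mem_unitaryGroup_holds

/-- The matrix of `cnotPerm p q` is `CNOT`, hence generated (`p ≠ q`). [folklore] -/
theorem inGen_cnotPerm {p q : Fin n} (hpq : p ≠ q) : InGen n ((cnotPerm p q).permMatrix ℂ) := by
  rw [cnotPerm, ← mc_pauliX]
  exact inGen_mc_singleton_pauliX hpq

/-! ### The canonical pair and the bridge to `∧_C(W)` -/

/-- The canonical lower label for pivot `p`: all bits `1` except bit `p`. [folklore] -/
def canonX (p : Fin n) : QReg n := Function.update (fun _ => true) p false

/-- The canonical upper label: all bits `1`. [folklore] -/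
def canonY (n : ℕ) : QReg n := fun _ => true

/-- Bits of `canonX`. [folklore] -/
theorem canonX_apply (p i : Fin n) : canonX p i = decide (i ≠ p) := by
  by_cases h : i = p
  · subst h; simp [canonX]
  · simp [canonX, h]

/-- A label with all bits `1` off `p` is canonical. [folklore] -/
theorem eq_canon_of_bits {p : Fin n} {u : QReg n} (hu : ∀ i, i ≠ p → u i = true) :
    u = (if u p = true then canonY n else canonX p) := by
  funext i
  by_cases hup : u p = true
  · rw [if_pos hup]
    by_cases hi : i = p
    · subst hi; exact hup
    · exact hu i hi
  · rw [if_neg hup, canonX_apply]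
    by_cases hi : i = p
    · subst hi; simpa using hup
    · rw [hu i hi]; simp [hi]

/-- **The two-level unitary on the canonical pair is the fully controlled gate**
`∧_{univ ∖ {p}}([[a, b], [c, d]])` on target `p` (Nielsen–Chuang 2010, §4.5.2, Fig. 4.16: after
the Gray-code moves "the final transformation is a controlled-`Ũ`").
[cite: NielsenChuang2010, §4.5.2] -/
theorem twoLevel_canon_eq_mc (p : Fin n) (a b c d : ℂ) :
    twoLevel (canonX p) (canonY n) a b c d = mc (Finset.univ.erase p) p (m2 a b c d) := by
  have hXp : canonX p p = false := by simp [canonX]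
  have hYp : canonY n p = true := rfl
  have hXY : canonX p ≠ canonY n := fun h => by
    have := congrFun h p; rw [hXp, hYp] at this; exact Bool.false_ne_true this
  ext u v
  rw [mc, ctrl_apply]
  simp only [Finset.mem_erase, Finset.mem_univ, and_true]
  by_cases huv : ∀ i, i ≠ p → u i = v i
  · rw [if_pos huv, clr_eq_of_agree huv]
    by_cases hall : ∀ c, c ≠ p → clr p u c = true
    · rw [if_pos hall]
      have hu' : ∀ i, i ≠ p → u i = true := fun i hi => by rw [← clr_apply_of_ne hi u]; exact hall i hi
      have hv' : ∀ i, i ≠ p → v i = true := fun i hi => (huv i hi) ▸ hu' i hi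
      have hu := eq_canon_of_bits hu'
      have hv := eq_canon_of_bits hv'
      rw [m2_apply]
      change twoLevel (canonX p) (canonY n) a b c d u v = if u p = true then _ else _
      cases hup : u p <;> cases hvp : v p <;>
        simp only [hup, hvp, if_true, if_false, Bool.false_eq_true] at hu hv ⊢ <;>
        (rw [hu, hv]; simp [twoLevel, hXY.symm])
    · rw [if_neg hall]
      push Not at hall
      obtain ⟨c₀, hc₀p, hc₀⟩ := hall
      rw [clr_apply_of_ne hc₀p] at hc₀
      have huX : u ≠ canonX p := fun h => hc₀ (by rw [h, canonX_apply]; simp [hc₀p])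
      have huY : u ≠ canonY n := fun h => hc₀ (by rw [h]; rfl)
      rw [twoLevel_apply_of_ne a b c d huX huY, Matrix.one_apply, Matrix.one_apply]
      by_cases hupv : u p = v p
      · rw [if_pos (funext fun _ => hupv), if_pos]
        rw [eq_update_of_agree huv, ← hupv]; simp
      · rw [if_neg (show ¬ ((fun _ : Fin 1 => u p) = fun _ => v p) from fun h => hupv (congrFun h 0)),
          if_neg]
        intro h; exact hupv (by rw [h])
  · rw [if_neg huv]
    have hne : u ≠ v := fun h => huv (h ▸ fun _ _ => rfl)
    -- `u`, `v` cannot both be canonical (the canonical labels agree off `p`)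
    by_cases hu : u = canonX p ∨ u = canonY n
    · have hv : v ≠ canonX p ∧ v ≠ canonY n := by
        constructor <;> rintro rfl <;> apply huv <;> intro i hi <;> rcases hu with rfl | rfl <;>
          simp [canonX_apply, canonY, hi]
      simp only [twoLevel]
      rcases hu with rfl | rfl
      · rw [if_pos rfl, if_neg hv.1, if_neg hv.2]
      · rw [if_neg hXY.symm, if_pos rfl, if_neg hv.1, if_neg hv.2]
    · push Not at hu
      rw [twoLevel_apply_of_ne a b c d hu.1 hu.2, Matrix.one_apply_ne hne]

/-- **The block of a two-level unitary is unitary.** [folklore] -/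
theorem m2_mem_unitaryGroup_of_twoLevel {x y : QReg n} (hxy : x ≠ y) {a b c d : ℂ}
    (hU : twoLevel x y a b c d ∈ Matrix.unitaryGroup (QReg n) ℂ) :
    m2 a b c d ∈ Matrix.unitaryGroup (QReg 1) ℂ := by
  have h := Matrix.mem_unitaryGroup_iff.1 hU
  rw [star_twoLevel a b c d hxy, twoLevel_mul_twoLevel hxy] at h
  have exx := congrFun (congrFun h x) x
  have exy := congrFun (congrFun h x) y
  have eyx := congrFun (congrFun h y) x
  have eyy := congrFun (congrFun h y) y
  simp only [twoLevel, if_neg hxy, if_neg hxy.symm, Matrix.one_apply_eq,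
    Matrix.one_apply_ne hxy, Matrix.one_apply_ne hxy.symm, if_true] at exx exy eyx eyy
  rw [Matrix.mem_unitaryGroup_iff, star_m2, m2_mul_m2, one_eq_m2, m2_inj]
  simp only [Complex.star_def] at exx exy eyx eyy
  exact ⟨exx, exy, eyx, eyy⟩

/-! ### Reduction of a two-level unitary to the canonical pair -/

/-- The weight of the bit pair `(x_q, y_q)`: `0` for `(1,1)`, `1` for `(1,0)`, `2` otherwise; it
strictly decreases along the moves `X_q : (0,0) ↦ (1,1), (0,1) ↦ (1,0)` and
`CNOT_{p→q} : (1,0) ↦ (1,1)`. [folklore] -/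
def pairWeight (b₁ b₂ : Bool) : ℕ := if b₁ = true then (if b₂ = true then 0 else 1) else 2

/-- The badness of a pair of labels relative to the pivot `p`. [folklore] -/
def badness (p : Fin n) (x y : QReg n) : ℕ := ∑ q ∈ Finset.univ.erase p, pairWeight (x q) (y q)

/-- Zero badness means both labels are all-`1` off the pivot. [folklore] -/
theorem bits_of_badness_eq_zero {p : Fin n} {x y : QReg n} (h : badness p x y = 0) :
    ∀ q, q ≠ p → x q = true ∧ y q = true := by
  intro q hq
  have hq' : q ∈ Finset.univ.erase p := Finset.mem_erase.2 ⟨hq, Finset.mem_univ q⟩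
  have hw := (Finset.sum_eq_zero_iff.1 h) q hq'
  revert hw
  unfold pairWeight
  cases x q <;> cases y q <;> simp

/-- Changing the bits on one wire `q ≠ p` changes the badness by the change of that weight.
[folklore] -/
theorem badness_update {p q : Fin n} (hqp : q ≠ p) (x y : QReg n) (b₁ b₂ : Bool) :
    badness p (Function.update x q b₁) (Function.update y q b₂) + pairWeight (x q) (y q) =
      badness p x y + pairWeight b₁ b₂ := by
  unfold badness
  have hq : q ∈ Finset.univ.erase p := Finset.mem_erase.2 ⟨hqp, Finset.mem_univ q⟩
  rw [← Finset.add_sum_erase _ _ hq, ← Finset.add_sum_erase _ _ hq]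
  simp only [Function.update_self]
  have hrest : ∑ i ∈ (Finset.univ.erase p).erase q, pairWeight (Function.update x q b₁ i) (Function.update y q b₂ i) =
      ∑ i ∈ (Finset.univ.erase p).erase q, pairWeight (x i) (y i) := by
    refine Finset.sum_congr rfl fun i hi => ?_
    have hiq : i ≠ q := Finset.ne_of_mem_erase hi
    rw [Function.update_of_ne hiq, Function.update_of_ne hiq]
  rw [hrest]
  ring

/-- **Reduction to the canonical pair** (the wire bookkeeping of Nielsen–Chuang 2010, §4.5.2,
with `CNOT`/`X` conjugations in place of Gray codes): every two-level unitary on labels `x, y` with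
`x_p = 0`, `y_p = 1` is generated by one-qubit gates and `CNOT`s — by induction on the badness,
conjugating by `X_q` or `CNOT_{p→q}` on a bad wire `q`, down to the canonical pair, where
`twoLevel_canon_eq_mc` and `inGen_mc` apply. [cite: NielsenChuang2010, §4.5.2] -/
theorem inGen_twoLevel_of_badness_le : ∀ (k : ℕ) (p : Fin n) (x y : QReg n), badness p x y ≤ k →
    x p = false → y p = true → ∀ a b c d : ℂ,
      twoLevel x y a b c d ∈ Matrix.unitaryGroup (QReg n) ℂ → InGen n (twoLevel x y a b c d) := by
  intro k
  induction k with
  | zero =>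
    intro p x y hk hxp hyp a b c d hU
    have hbits := bits_of_badness_eq_zero (Nat.le_zero.1 hk)
    have hx : x = canonX p := by
      rw [eq_canon_of_bits (fun i hi => (hbits i hi).1), if_neg (by simp [hxp])]
    have hy : y = canonY n := by
      rw [eq_canon_of_bits (fun i hi => (hbits i hi).2), if_pos hyp]
    have hxy : x ≠ y := fun h => by rw [h, hyp] at hxp; exact Bool.noConfusion hxp
    have hW := m2_mem_unitaryGroup_of_twoLevel hxy hU
    rw [hx, hy, twoLevel_canon_eq_mc]
    exact inGen_mc _ _ p rfl (Finset.notMem_erase p _) _ hW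
  | succ k ih =>
    intro p x y hk hxp hyp a b c d hU
    by_cases hk' : badness p x y ≤ k
    · exact ih p x y hk' hxp hyp a b c d hU
    -- a bad wire `q ≠ p`
    obtain ⟨q, hq, hqw⟩ : ∃ q ∈ Finset.univ.erase p, pairWeight (x q) (y q) ≠ 0 := by
      by_contra hno
      push Not at hno
      have : badness p x y = 0 := Finset.sum_eq_zero hno
      omega
    have hqp : q ≠ p := Finset.ne_of_mem_erase hq
    -- the move: `X_q` unless the bits are `(1, 0)`, in which case `CNOT_{p → q}`
    by_cases hcase : x q = true ∧ y q = false
    · -- `CNOT_{p→q}`: fixes `x` (`x_p = 0`), flips `y_q` (`y_p = 1`)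
      obtain ⟨hxq, hyq⟩ := hcase
      have hσx : cnotPerm p q x = x := by rw [cnotPerm_apply hqp.symm, hxp]; simp
      have hσy : cnotPerm p q y = Function.update y q true := by
        rw [cnotPerm_apply hqp.symm, hyp, if_pos rfl, hyq]; rfl
      apply InGen.of_perm (cnotPerm_inv p q) (inGen_cnotPerm hqp.symm)
      rw [hσx, hσy]
      have hbad : badness p x (Function.update y q true) ≤ k := by
        have h1 := badness_update hqp x y (x q) true
        rw [Function.update_eq_self] at h1
        rw [hxq, hyq] at h1
        simp only [pairWeight, if_true, Bool.false_eq_true, if_false] at h1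
        omega
      refine ih p x _ hbad hxp (by rwa [Function.update_of_ne hqp.symm]) a b c d ?_
      -- unitarity of the relabelled matrix
      have key := permMatrix_conj_twoLevel (cnotPerm p q) x y a b c d
      rw [show (cnotPerm p q).symm = cnotPerm p q from by
        rw [← Equiv.Perm.inv_def, cnotPerm_inv], hσx, hσy] at key
      rw [← key]
      exact Submonoid.mul_mem _ (Submonoid.mul_mem _ (permMatrix_mem_unitaryGroup _) hU)
        (permMatrix_mem_unitaryGroup _)
    · -- `X_q`: `(0,0) ↦ (1,1)`, `(0,1) ↦ (1,0)`
      have hxq : x q = false := by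
        revert hcase hqw; unfold pairWeight
        cases x q <;> cases y q <;> simp
      have hσx : xPerm q x = Function.update x q true := by rw [xPerm_apply, hxq]; rfl
      have hσy : xPerm q y = Function.update y q (!y q) := xPerm_apply q y
      apply InGen.of_perm (xPerm_inv q) (inGen_xPerm q)
      rw [hσx, hσy]
      have hbad : badness p (Function.update x q true) (Function.update y q (!y q)) ≤ k := by
        have h1 := badness_update hqp x y true (!y q)
        rw [hxq] at h1
        revert h1 hk
        unfold pairWeight
        cases y q <;> simp <;> omega
      refine ih p _ _ hbad (by rwa [Function.update_of_ne hqp.symm])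
        (by rwa [Function.update_of_ne hqp.symm]) a b c d ?_
      have key := permMatrix_conj_twoLevel (xPerm q) x y a b c d
      rw [show (xPerm q).symm = xPerm q from by rw [← Equiv.Perm.inv_def, xPerm_inv], hσx, hσy] at key
      rw [← key]
      exact Submonoid.mul_mem _ (Submonoid.mul_mem _ (permMatrix_mem_unitaryGroup _) hU)
        (permMatrix_mem_unitaryGroup _)

/-- **Every two-level unitary on `n` wires is generated by one-qubit gates and `CNOT`s**
(Nielsen–Chuang 2010, §4.5.2; Barenco et al. 1995, §8). [cite: NielsenChuang2010, §4.5.2] -/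
theorem inGen_twoLevel {x y : QReg n} (hxy : x ≠ y) (a b c d : ℂ)
    (hU : twoLevel x y a b c d ∈ Matrix.unitaryGroup (QReg n) ℂ) : InGen n (twoLevel x y a b c d) := by
  obtain ⟨p, hp⟩ := Function.ne_iff.1 hxy
  cases hxp : x p
  · have hyp : y p = true := by
      revert hp; rw [hxp]; cases y p <;> simp
    exact inGen_twoLevel_of_badness_le _ p x y le_rfl hxp hyp a b c d hU
  · have hyp : y p = false := by
      revert hp; rw [hxp]; cases y p <;> simp
    rw [twoLevel_swap hxy] at hU ⊢
    exact inGen_twoLevel_of_badness_le _ p y x le_rfl hyp hxp d c b a hU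

end Barenco

/-! ### The theorem -/

open Barenco Cryptography in
/-- **Exact universality of one-qubit gates and `CNOT`** (Barenco–Bennett–Cleve–DiVincenzo–
Margolus–Shor–Sleator–Smolin–Weinfurter 1995, abstract and §8; Nielsen–Chuang 2010, §4.5.2):
for every `n ≥ 1` the subgroup of `U(2^n)` generated by the placements of one-qubit unitaries
and of `CNOT` is all of `U(2^n)`. Discharge of the named fact `barenco1995_exactUniversality`:
every unitary is a product of two-level unitaries (`mem_twoLevelClosure`), and each of those is
generated (`Barenco.inGen_twoLevel`). [cite: BarencoEtAl1995, abstract and §8] -/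
theorem barenco1995_exactUniversality_holds : barenco1995_exactUniversality := by
  intro n hn
  haveI : Nonempty (Fin n) := ⟨⟨0, hn⟩⟩
  rw [eq_top_iff]
  intro U _
  have hall : ∀ M ∈ twoLevelClosure (QReg n), InGen n M := by
    intro M hM
    induction hM using Submonoid.closure_induction with
    | mem M hM =>
      obtain ⟨x, y, a, b, c, d, hxy, rfl, hu⟩ := hM
      exact inGen_twoLevel hxy a b c d hu
    | one => exact inGen_one
    | mul M N _ _ ihM ihN => exact ihM.mul ihN
  exact (hall _ (mem_twoLevelClosure U.2)).mem

/-- With Barenco et al. discharged, **`cliffordT_isUniversal` follows from the density of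
`⟨H, T⟩` in `U(2)` modulo phase alone** (Boykin et al. 1999, §3, first step).
[cite: BoykinEtAl1999, §3] -/
theorem cliffordT_isUniversal_of_HT (hD : boykin1999_HT_generatesDenselyModPhase) :
    cliffordT_isUniversal :=
  cliffordT_isUniversal_of barenco1995_exactUniversality_holds hD

/-- Likewise for the literal `{H, T, CNOT}` form of S08. [cite: BoykinEtAl1999, §3] -/
theorem hTCnot_generatesDenselyModPhase_of_HT (hD : boykin1999_HT_generatesDenselyModPhase) :
    hTCnot_generatesDenselyModPhase :=
  hTCnot_generatesDenselyModPhase_of barenco1995_exactUniversality_holds hD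

end Literature.Computability.QuantumComplexity
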